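import Summits.QuantumFields.YangMills.Theorems.BalabanUVNodesN15PerCubeGreenFineAdjointRows
import Summits.QuantumFields.YangMills.Theorems.BalabanUVNodesN15PerCubeGreenTwoGridCutRows
import Summits.QuantumFields.YangMills.Theorems.BalabanUVNodesN15CommutatorOutputSupport
import HarnessLib

/-!
# N15 = NE2, road (c) — PROGRAMME (PC), (PC-E-K) ENTRY 2 «`G′(U)∇*_U` of [B9] (3.42) for the NAMED scalar covariant Green's function, TWO GRIDS»: TWO-GRID SITE ROWS OF THE ADJOINT
# KNIT — the cut-row defects of the PLATEAU-COMPRESSED cubes `N′_k = M_{ψ_k}G′(1)M_{ψ_k}` from dag-n15-a's flat two-grid rows, and the RIGHT-FORM support of the conjugated fine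
# operator from `supp h′_k` (n15-c∕427's `hDcut`, `hDcutF`, `hDcutB`, `hΔψ′` on sites; dag-n15-c g37, n15-c∕429d)

Cell `pub-ymgap`, seat `pub-ymgap-dag-n15-c` (generation g37; R134 (a), s1; HUMAN RULING D-0062).  `bears_on: R4∕N15 · K3⁸ SpineGivenEndpointR13SepCoPHV (stmt-QuantumFields-27366)`;
filed `--kind proof --supports stmt-QuantumFields-27366 --as helper` — COUNT-NEUTRAL.  Theorems only; 0 `def`, 0 `sorry`.  Imports BY NAME n15-c∕428b `…PerCubeGreenFineAdjointRows`
(`mulOp_scChi'_comp_mulOp_scPsi'`, `mulOp_scChi'_comp_fgrad∕bgrad_comp_mulOp_scPsi'`, `scPsi'_near_scChi'`; through it n15-c∕282a's coarse margins), n15-c∕338 `…PerCubeGreenTwoGridCutRows`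
(`hasMaj_idef_cut∕cutF∕cutB_scCube`: 53's two-grid cut rows for the cubes `G′(1)M_ψ` from Ξ-4 rows 9∕10∕12), dag-n15-a `…CommutatorOutputSupport` (`mulOp_fst_comp_conj_comp_mulOp_fst_eq_zero`,
`mulOp_comp_add_comp_mulOp_eq_zero`; dag-n15-w3 `mulOp_comp_covLapM_comp_mulOp_eq_zero`).  Nothing in the tree is modified; nothing restated.

WHY.  n15-c∕427 (✓) displays, beyond n15-c∕281′'s one-grid data (packaged by n15-c∕429c∕429f), (i) the two-grid defects of the CUT ROWS of the adjoint line's cubes `N′_k = M_ψ∘(G′(1)M_ψ)`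
— n15-c∕338 proved them for entry 0's cubes `G′(1)M_ψ`; the extra output plateau is absorbed by the margins (`M_χM_ψ = M_χ`, `M_χ∇^±M_ψ = M_χ∇^±`, both grids) — and (ii) the RIGHT-form
support `M_{h′_k}∘(M_W(Δ_{R_U′} + P′)M_{Wᵀ})∘M_{ψ′_k} = M_{h′_k}∘(M_W(Δ_{R_U′} + P′)M_{Wᵀ})` (`hΔψ′`: the adjoint arrangement reads the cube from the RIGHT, so the support row of
n15-c∕339's `hKout` — dag-n15-a `mulOp_one_sub_scPsi_comp_covLapM_comp_mulOp_scH`, LEFT form — is needed transposed: the covariant Laplacian moves `supp h′_k ⊆ {χ′_k ≠ 0}` by one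
step, inside the plateau (n15-c∕428b `scPsi'_near_scChi'`), and the summand's right locality `M_{h′}P′M_{1−ψ′} = 0` is displayed for n15-c∕430).

WHAT.  §1 ★★ `hasMaj_idef_cut_scCubeP`, `hasMaj_idef_cutF_scCubeP`, `hasMaj_idef_cutB_scCubeP` (427's `hDcut`∕`hDcutF`∕`hDcutB` at the site objects, from Ξ-4-shaped rows, any
nonnegative kernel `K`).  §2 `scH'_mul_one_sub_scPsi'_stencil`, ★ `mulOp_scH'_comp_covLapM_comp_one_sub_scPsi'` (`M_{h′}Δ_RM_{1−ψ′} = 0`, every bond transport `R`),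
★★ `mulOp_scH'_comp_conj_comp_mulOp_scPsi'` (427's `hΔψ′` given the summand's right locality).

HONEST FRAMING ∕ LIMITS.  Lattice bookkeeping on the MODEL site carriers; the flat two-grid rows are HYPOTHESES (dag-n15-a Ξ-4 `flatRowsAll_king` r9∕r10∕r12 supply them); nothing of
[B5]∕[B6]∕[B9] asserted (Thm 3.14 pp.426–427 = template; (3.50) p.400, (3.62)–(3.65) pp.402–403, (3.87)–(3.89) p.409, [B6-II] (2.37) p.229, (2.91)–(2.93) p.239 = SHAPES).  NE2⁺ NOT
PRINTED, NOT proved; N15 of record untouched (DISCHARGED AS CONSUMED, p687738); K3⁸ OPEN; counts of record UNMOVED (typed 28∕28 · discharged 8∕27); one finite 𝕋⁴ at fixed ε per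
index — NOT infinite volume, NOT OS on ℝ⁴, NOT a mass gap, NOT Clay.  Restate-immune (no Theses import).
-/

noncomputable section

open scoped BigOperators Matrix

namespace Summit.QuantumFields.YangMills.BalabanUVNodes.N15.Gluing

open Real
open Literature.MathematicalPhysics.QuantumFieldTheory.Balaban1983to89
open Literature.MathematicalPhysics.QuantumFieldTheory.Balaban1983to89.B5Prop11Plancherel (Tor fine unitVec)
open Literature.MathematicalPhysics.QuantumFieldTheory.Balaban1983to89.B11SectG (BlockNorm HasMaj)
open Literature.MathematicalPhysics.QuantumFieldTheory.Balaban1983to89.B6Prop26Gluing (mulOp mulOp_apply ind ind_nonneg)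
open Literature.MathematicalPhysics.QuantumFieldTheory.Balaban1983to89.B6UnitTorusCarrier (unitTorusGeo)
open Literature.MathematicalPhysics.QuantumFieldTheory.Balaban1983to89.T4EtaRateDefect (idef idef_comp)
open Literature.MathematicalPhysics.QuantumFieldTheory.Balaban1983to89.T4EtaRateCoeffDefect (pull pull_apply)
open Literature.MathematicalPhysics.QuantumFieldTheory.King1986.Torus (blockOf tdistT tdistT_nonneg)
open Summit.QuantumFields.YangMills.BalabanUVNodes.N15.BackgroundLayer (fgrad bgrad fgrad_apply bgrad_apply covLapM)
open Summit.QuantumFields.YangMills.BalabanUVNodes.N15.VectorPiece (kingPr kingPrV kingPrV_eq)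
open Summit.QuantumFields.YangMills.BalabanUVNodes.N15.MatrixSpecies (mmulOp liftBlk liftMap liftEquiv liftEquiv_apply liftEquiv_symm_apply)
open Summit.QuantumFields.YangMills.BalabanUVNodes.N15.TwoGrid (chiCube cubeBlocks chiCube_of_not_mem abs_chiCube_le_one)
open Summit.QuantumFields.YangMills.BalabanUVNodes.N15.CurvedSpecies (mulOp_comp_covLapM_comp_mulOp_eq_zero)
open Summit.QuantumFields.YangMills.BalabanUVNodes.N15.CovLandau (cgrad cGreen bBack)

variable {d : ℕ}

/-! ## §1 The two-grid cut-row defects of the plateau-compressed cubes `N′_k = M_{ψ_k}∘G′(1)∘M_{ψ_k}` -/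

section CutDefects

variable {L : ℕ} [NeZero L] {mv kk r : ℕ} {hL : Odd L ∧ 1 < L} (ι : Type) [Fintype ι] [DecidableEq ι]
variable (hM : ∀ ν, cvM d L mv kk hL ν = 2 * L * L ^ mv) (hm₁ : 2 * L ^ mv ≤ coverMargin L mv) (hfitI : coverMargin L mv - 2 * L ^ mv + (6 * L ^ mv + 1) ≤ L * L ^ mv)
  (hm₂ : 2 * L ^ mv + 1 ≤ coverMargin L mv) (hfit₂ : coverMargin L mv - 2 * L ^ mv + (6 * L ^ mv + 1) + 1 ≤ L * L ^ mv) (hS0 : L * L ^ mv ≤ 2 * L * L ^ mv)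
include hM hm₁ hfitI hm₂ hfit₂ hS0

/-- ★★ [hDcut] for the P-cubes: `𝔇_{P̂,P̂}(M_{χ′_k}N′′_k, M_{χ_k}N′_k) = 𝔇_{P̂,P̂}(M_{χ′_k}G′′(1)M_{ψ′_k}, M_{χ_k}G′(1)M_{ψ_k}) ≤ 1_□1_□·K` (margins `M_χM_ψ = M_χ` at both grids, then n15-c∕338).
[cite: Balaban1985BackgroundPropagators, Thm 3.14 pp.426–427 (two-grid difference: template), (3.87) p.409, (3.62)–(3.65) pp.402–403; King1986, p.664] -/
theorem hasMaj_idef_cut_scCubeP {a a' : ℝ} {K : Tor (cvM d L mv kk hL) → Tor (cvM d L mv kk hL) → ℝ} (hK : ∀ y y', 0 ≤ K y y')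
    (hDG : HasMaj (ScNorm d L mv kk hL ι) (BlockNorm.ofBlocks (unitTorusGeo L kk (cvM d L mv kk hL)) (liftBlk (blockOf (L ^ r * L ^ kk) (cvM d L mv kk hL)) ι))
      (idef (pull (liftMap (kingPr L kk r (cvM d L mv kk hL)) ι)) (pull (liftMap (kingPr L kk r (cvM d L mv kk hL)) ι)) (Matrix.mulVecLin (cGreen (cvM d L mv kk hL) (L ^ r * L ^ kk) (fun (_ : Fin (d + 1)) (_ : ScX' d L mv kk r hL) => (1 : Matrix ι ι ℝ)) a')) (Matrix.mulVecLin (cGreen (cvM d L mv kk hL) (L ^ kk) (fun (_ : Fin (d + 1)) (_ : ScX d L mv kk hL) => (1 : Matrix ι ι ℝ)) a))) K)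
    (k : Fin (d + 1) → ZMod (2 * L)) :
    HasMaj (ScNorm d L mv kk hL ι) (BlockNorm.ofBlocks (unitTorusGeo L kk (cvM d L mv kk hL)) (liftBlk (scBlk d L mv kk hL) ι ∘ liftMap (kingPr L kk r (cvM d L mv kk hL)) ι))
      (idef (pull (liftMap (kingPr L kk r (cvM d L mv kk hL)) ι)) (pull (liftMap (kingPr L kk r (cvM d L mv kk hL)) ι)) (mulOp (fun p : ScX' d L mv kk r hL × ι => scChi' d L mv kk r hL k p.1) ∘ₗ (mulOp (fun p : ScX' d L mv kk r hL × ι => scPsi' d L mv kk r hL k p.1) ∘ₗ scCube' d L mv kk r hL a' ι k)) (mulOp (fun p : ScX d L mv kk hL × ι => scChi d L mv kk hL k p.1) ∘ₗ (mulOp (fun p : ScX d L mv kk hL × ι => scPsi d L mv kk hL k p.1) ∘ₗ scCube d L mv kk hL a ι k)))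
      (fun y y' => ind (cvSk d L mv kk hL k) y * ind (cvSk d L mv kk hL k) y' * K y y') := by
  rw [← LinearMap.comp_assoc, mulOp_scChi'_comp_mulOp_scPsi' ι hM hm₂ hfit₂ hS0, ← LinearMap.comp_assoc, mulOp_scChi_comp_mulOp_scPsi ι hM hm₂ hfit₂ hS0]
  exact hasMaj_idef_cut_scCube ι hM hm₁ hfitI hS0 hK hDG k

/-- ★★ [hDcutF] for the P-cubes: `𝔇_{P̂,P̂}(M_{χ′_k}∇′_μN′′_k, M_{χ_k}∇_μN′_k) ≤ 1_□1_□·K` (margins `M_χ∇⁺M_ψ = M_χ∇⁺` at both grids, then n15-c∕338 from Ξ-4 r10's shape).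
[cite: Balaban1985BackgroundPropagators, Thm 3.14 pp.426–427 (template), (3.62)–(3.65) pp.402–403; King1986, p.664] -/
theorem hasMaj_idef_cutF_scCubeP {a a' : ℝ} {K : Tor (cvM d L mv kk hL) → Tor (cvM d L mv kk hL) → ℝ} (hK : ∀ y y', 0 ≤ K y y') (μ : Fin (d + 1))
    (hDGF : HasMaj (ScNorm d L mv kk hL ι) (BlockNorm.ofBlocks (unitTorusGeo L kk (cvM d L mv kk hL)) (liftBlk (fun b : ScX' d L mv kk r hL × Fin (d + 1) => blockOf (L ^ r * L ^ kk) (cvM d L mv kk hL) b.1) ι))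
      (idef (pull (liftMap (kingPr L kk r (cvM d L mv kk hL)) ι)) (pull (liftMap (kingPrV L kk r (cvM d L mv kk hL)) ι)) (Matrix.mulVecLin (cgrad (cvM d L mv kk hL) (L ^ r * L ^ kk) (fun (_ : Fin (d + 1)) (_ : ScX' d L mv kk r hL) => (1 : Matrix ι ι ℝ)) * cGreen (cvM d L mv kk hL) (L ^ r * L ^ kk) (fun (_ : Fin (d + 1)) (_ : ScX' d L mv kk r hL) => (1 : Matrix ι ι ℝ)) a')) (Matrix.mulVecLin (cgrad (cvM d L mv kk hL) (L ^ kk) (fun (_ : Fin (d + 1)) (_ : ScX d L mv kk hL) => (1 : Matrix ι ι ℝ)) * cGreen (cvM d L mv kk hL) (L ^ kk) (fun (_ : Fin (d + 1)) (_ : ScX d L mv kk hL) => (1 : Matrix ι ι ℝ)) a))) K)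
    (k : Fin (d + 1) → ZMod (2 * L)) :
    HasMaj (ScNorm d L mv kk hL ι) (BlockNorm.ofBlocks (unitTorusGeo L kk (cvM d L mv kk hL)) (liftBlk (scBlk d L mv kk hL) ι ∘ liftMap (kingPr L kk r (cvM d L mv kk hL)) ι))
      (idef (pull (liftMap (kingPr L kk r (cvM d L mv kk hL)) ι)) (pull (liftMap (kingPr L kk r (cvM d L mv kk hL)) ι)) (mulOp (fun p : ScX' d L mv kk r hL × ι => scChi' d L mv kk r hL k p.1) ∘ₗ (fgrad ((((L ^ r * L ^ kk : ℕ) : ℝ))⁻¹)⁻¹ (liftEquiv (scShift' d L mv kk r hL μ) ι) ∘ₗ (mulOp (fun p : ScX' d L mv kk r hL × ι => scPsi' d L mv kk r hL k p.1) ∘ₗ scCube' d L mv kk r hL a' ι k)))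
        (mulOp (fun p : ScX d L mv kk hL × ι => scChi d L mv kk hL k p.1) ∘ₗ (fgrad ((((L ^ kk : ℕ) : ℝ))⁻¹)⁻¹ (liftEquiv (scShift d L mv kk hL μ) ι) ∘ₗ (mulOp (fun p : ScX d L mv kk hL × ι => scPsi d L mv kk hL k p.1) ∘ₗ scCube d L mv kk hL a ι k))))
      (fun y y' => ind (cvSk d L mv kk hL k) y * ind (cvSk d L mv kk hL k) y' * K y y') := by
  have e : mulOp (fun p : ScX d L mv kk hL × ι => scChi d L mv kk hL k p.1) ∘ₗ (fgrad ((((L ^ kk : ℕ) : ℝ))⁻¹)⁻¹ (liftEquiv (scShift d L mv kk hL μ) ι) ∘ₗ (mulOp (fun p : ScX d L mv kk hL × ι => scPsi d L mv kk hL k p.1) ∘ₗ scCube d L mv kk hL a ι k)) =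
      (mulOp (fun p : ScX d L mv kk hL × ι => scChi d L mv kk hL k p.1) ∘ₗ fgrad ((((L ^ kk : ℕ) : ℝ))⁻¹)⁻¹ (liftEquiv (scShift d L mv kk hL μ) ι) ∘ₗ mulOp (fun p : ScX d L mv kk hL × ι => scPsi d L mv kk hL k p.1)) ∘ₗ scCube d L mv kk hL a ι k := by
    simp only [LinearMap.comp_assoc]
  have e' : mulOp (fun p : ScX' d L mv kk r hL × ι => scChi' d L mv kk r hL k p.1) ∘ₗ (fgrad ((((L ^ r * L ^ kk : ℕ) : ℝ))⁻¹)⁻¹ (liftEquiv (scShift' d L mv kk r hL μ) ι) ∘ₗ (mulOp (fun p : ScX' d L mv kk r hL × ι => scPsi' d L mv kk r hL k p.1) ∘ₗ scCube' d L mv kk r hL a' ι k)) =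
      (mulOp (fun p : ScX' d L mv kk r hL × ι => scChi' d L mv kk r hL k p.1) ∘ₗ fgrad ((((L ^ r * L ^ kk : ℕ) : ℝ))⁻¹)⁻¹ (liftEquiv (scShift' d L mv kk r hL μ) ι) ∘ₗ mulOp (fun p : ScX' d L mv kk r hL × ι => scPsi' d L mv kk r hL k p.1)) ∘ₗ scCube' d L mv kk r hL a' ι k := by
    simp only [LinearMap.comp_assoc]
  rw [e, e', mulOp_scChi_comp_fgrad_comp_mulOp_scPsi ι hM hm₂ hfit₂ hS0, mulOp_scChi'_comp_fgrad_comp_mulOp_scPsi' ι hM hm₂ hfit₂ hS0, LinearMap.comp_assoc, LinearMap.comp_assoc]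
  exact hasMaj_idef_cutF_scCube ι hM hm₁ hfitI hS0 hK μ hDGF k

/-- ★★ [hDcutB] for the P-cubes (backward quotients; Ξ-4 r12's shape). [cite: Balaban1985BackgroundPropagators, Thm 3.14 pp.426–427 (template); Balaban1984PropagatorsI, (1.3) p.18; King1986, p.664] -/
theorem hasMaj_idef_cutB_scCubeP {a a' : ℝ} {K : Tor (cvM d L mv kk hL) → Tor (cvM d L mv kk hL) → ℝ} (hK : ∀ y y', 0 ≤ K y y') (μ : Fin (d + 1))
    (hDGB : HasMaj (ScNorm d L mv kk hL ι) (BlockNorm.ofBlocks (unitTorusGeo L kk (cvM d L mv kk hL)) (liftBlk (fun b : ScX' d L mv kk r hL × Fin (d + 1) => blockOf (L ^ r * L ^ kk) (cvM d L mv kk hL) b.1) ι))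
      (idef (pull (liftMap (kingPr L kk r (cvM d L mv kk hL)) ι)) (pull (liftMap (kingPrV L kk r (cvM d L mv kk hL)) ι)) (Matrix.mulVecLin (bBack (cvM d L mv kk hL) (L ^ r * L ^ kk) (ι := ι) * (cgrad (cvM d L mv kk hL) (L ^ r * L ^ kk) (fun (_ : Fin (d + 1)) (_ : ScX' d L mv kk r hL) => (1 : Matrix ι ι ℝ)) * cGreen (cvM d L mv kk hL) (L ^ r * L ^ kk) (fun (_ : Fin (d + 1)) (_ : ScX' d L mv kk r hL) => (1 : Matrix ι ι ℝ)) a'))) (Matrix.mulVecLin (bBack (cvM d L mv kk hL) (L ^ kk) (ι := ι) * (cgrad (cvM d L mv kk hL) (L ^ kk) (fun (_ : Fin (d + 1)) (_ : ScX d L mv kk hL) => (1 : Matrix ι ι ℝ)) * cGreen (cvM d L mv kk hL) (L ^ kk) (fun (_ : Fin (d + 1)) (_ : ScX d L mv kk hL) => (1 : Matrix ι ι ℝ)) a)))) K)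
    (k : Fin (d + 1) → ZMod (2 * L)) :
    HasMaj (ScNorm d L mv kk hL ι) (BlockNorm.ofBlocks (unitTorusGeo L kk (cvM d L mv kk hL)) (liftBlk (scBlk d L mv kk hL) ι ∘ liftMap (kingPr L kk r (cvM d L mv kk hL)) ι))
      (idef (pull (liftMap (kingPr L kk r (cvM d L mv kk hL)) ι)) (pull (liftMap (kingPr L kk r (cvM d L mv kk hL)) ι)) (mulOp (fun p : ScX' d L mv kk r hL × ι => scChi' d L mv kk r hL k p.1) ∘ₗ (bgrad ((((L ^ r * L ^ kk : ℕ) : ℝ))⁻¹)⁻¹ (liftEquiv (scShift' d L mv kk r hL μ) ι) ∘ₗ (mulOp (fun p : ScX' d L mv kk r hL × ι => scPsi' d L mv kk r hL k p.1) ∘ₗ scCube' d L mv kk r hL a' ι k)))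
        (mulOp (fun p : ScX d L mv kk hL × ι => scChi d L mv kk hL k p.1) ∘ₗ (bgrad ((((L ^ kk : ℕ) : ℝ))⁻¹)⁻¹ (liftEquiv (scShift d L mv kk hL μ) ι) ∘ₗ (mulOp (fun p : ScX d L mv kk hL × ι => scPsi d L mv kk hL k p.1) ∘ₗ scCube d L mv kk hL a ι k))))
      (fun y y' => ind (cvSk d L mv kk hL k) y * ind (cvSk d L mv kk hL k) y' * K y y') := by
  have e : mulOp (fun p : ScX d L mv kk hL × ι => scChi d L mv kk hL k p.1) ∘ₗ (bgrad ((((L ^ kk : ℕ) : ℝ))⁻¹)⁻¹ (liftEquiv (scShift d L mv kk hL μ) ι) ∘ₗ (mulOp (fun p : ScX d L mv kk hL × ι => scPsi d L mv kk hL k p.1) ∘ₗ scCube d L mv kk hL a ι k)) =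
      (mulOp (fun p : ScX d L mv kk hL × ι => scChi d L mv kk hL k p.1) ∘ₗ bgrad ((((L ^ kk : ℕ) : ℝ))⁻¹)⁻¹ (liftEquiv (scShift d L mv kk hL μ) ι) ∘ₗ mulOp (fun p : ScX d L mv kk hL × ι => scPsi d L mv kk hL k p.1)) ∘ₗ scCube d L mv kk hL a ι k := by
    simp only [LinearMap.comp_assoc]
  have e' : mulOp (fun p : ScX' d L mv kk r hL × ι => scChi' d L mv kk r hL k p.1) ∘ₗ (bgrad ((((L ^ r * L ^ kk : ℕ) : ℝ))⁻¹)⁻¹ (liftEquiv (scShift' d L mv kk r hL μ) ι) ∘ₗ (mulOp (fun p : ScX' d L mv kk r hL × ι => scPsi' d L mv kk r hL k p.1) ∘ₗ scCube' d L mv kk r hL a' ι k)) =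
      (mulOp (fun p : ScX' d L mv kk r hL × ι => scChi' d L mv kk r hL k p.1) ∘ₗ bgrad ((((L ^ r * L ^ kk : ℕ) : ℝ))⁻¹)⁻¹ (liftEquiv (scShift' d L mv kk r hL μ) ι) ∘ₗ mulOp (fun p : ScX' d L mv kk r hL × ι => scPsi' d L mv kk r hL k p.1)) ∘ₗ scCube' d L mv kk r hL a' ι k := by
    simp only [LinearMap.comp_assoc]
  rw [e, e', mulOp_scChi_comp_bgrad_comp_mulOp_scPsi ι hM hm₂ hfit₂ hS0, mulOp_scChi'_comp_bgrad_comp_mulOp_scPsi' ι hM hm₂ hfit₂ hS0, LinearMap.comp_assoc, LinearMap.comp_assoc]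
  exact hasMaj_idef_cutB_scCube ι hM hm₁ hfitI hS0 hK μ hDGB k

end CutDefects

/-! ## §2 The RIGHT-form support of the fine operator from `supp h′_k`: `M_{h′_k}∘Δ′∘M_{1−ψ′_k} = 0` -/

section Support

variable {L : ℕ} [NeZero L] {mv kk r : ℕ} {hL : Odd L ∧ 1 < L} (ι : Type) [Fintype ι] [DecidableEq ι]
variable (hM : ∀ ν, cvM d L mv kk hL ν = 2 * L * L ^ mv) (hm₂ : 2 * L ^ mv + 1 ≤ coverMargin L mv)
  (hfit₂ : coverMargin L mv - 2 * L ^ mv + (6 * L ^ mv + 1) + 1 ≤ L * L ^ mv) (hS0 : L * L ^ mv ≤ 2 * L * L ^ mv)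
include hM hm₂ hfit₂ hS0

omit [Fintype ι] [DecidableEq ι] in
/-- THE RIGHT STENCIL FACTS on the fine grid: `h′_k(x)·(1 − ψ′_k(x)) = h′_k(x)·(1 − ψ′_k(x + e_μ)) = h′_k(x)·(1 − ψ′_k(x − e_μ)) = 0` (`supp h′_k ⊆ {χ′_k ≠ 0}`, n15-c∕428b `scPsi'_near_scChi'`).
[cite: Balaban1984PropagatorsII, (2.37) p.229 (shape)] -/
theorem scH'_mul_one_sub_scPsi'_stencil (k : Fin (d + 1) → ZMod (2 * L)) (hhχ : ∀ x, scH' d L mv kk r hL k x ≠ 0 → scChi' d L mv kk r hL k x ≠ 0) :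
    (∀ x, scH' d L mv kk r hL k x * (1 - scPsi' d L mv kk r hL k x) = 0) ∧ (∀ μ x, scH' d L mv kk r hL k x * (1 - scPsi' d L mv kk r hL k (scShift' d L mv kk r hL μ x)) = 0) ∧
      ∀ μ x, scH' d L mv kk r hL k x * (1 - scPsi' d L mv kk r hL k ((scShift' d L mv kk r hL μ).symm x)) = 0 := by
  refine ⟨fun x => ?_, fun μ x => ?_, fun μ x => ?_⟩
  · by_cases h0 : scH' d L mv kk r hL k x = 0
    · rw [h0, zero_mul]
    · rw [(scPsi'_near_scChi' hM hm₂ hfit₂ hS0 0 k (hhχ x h0)).1, sub_self, mul_zero]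
  · by_cases h0 : scH' d L mv kk r hL k x = 0
    · rw [h0, zero_mul]
    · rw [(scPsi'_near_scChi' hM hm₂ hfit₂ hS0 μ k (hhχ x h0)).2.1, sub_self, mul_zero]
  · by_cases h0 : scH' d L mv kk r hL k x = 0
    · rw [h0, zero_mul]
    · rw [(scPsi'_near_scChi' hM hm₂ hfit₂ hS0 μ k (hhχ x h0)).2.2, sub_self, mul_zero]

/-- ★ `M_{h′_k}∘Δ_R∘M_{1−ψ′_k} = 0` on the fine sites for Bałaban's covariant Laplacian with ANY bond transports `R` (dag-n15-w3 `mulOp_comp_covLapM_comp_mulOp_eq_zero` on the right stencil facts).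
[cite: Balaban1985BackgroundPropagators, (3.50) p.400 (shape); Balaban1984PropagatorsII, (2.37) p.229 (shape)] -/
theorem mulOp_scH'_comp_covLapM_comp_one_sub_scPsi' (η : ℝ) (R : Fin (d + 1) ⊕ Fin (d + 1) → ScX' d L mv kk r hL → Matrix ι ι ℝ) (k : Fin (d + 1) → ZMod (2 * L))
    (hhχ : ∀ x, scH' d L mv kk r hL k x ≠ 0 → scChi' d L mv kk r hL k x ≠ 0) :
    mulOp (fun p : ScX' d L mv kk r hL × ι => scH' d L mv kk r hL k p.1) ∘ₗ covLapM (scShift' d L mv kk r hL) η R ∘ₗ mulOp (fun p : ScX' d L mv kk r hL × ι => 1 - scPsi' d L mv kk r hL k p.1) = 0 :=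
  have hs := scH'_mul_one_sub_scPsi'_stencil hM hm₂ hfit₂ hS0 k hhχ
  mulOp_comp_covLapM_comp_mulOp_eq_zero (scShift' d L mv kk r hL) η R (hX := scH' d L mv kk r hL k) (kX := fun x => 1 - scPsi' d L mv kk r hL k x) hs.1 hs.2.1 hs.2.2

/-- ★★ **n15-c∕427's `hΔψ′` ON SITES**: `M_{h′_k}∘(M_W∘(Δ_R + P′)∘M_{W′})∘M_{ψ′_k} = M_{h′_k}∘(M_W∘(Δ_R + P′)∘M_{W′})` for all matrix coefficients `W, W′` (the cube's gauge pair), every bond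
transport `R`, and every summand `P′` with the RIGHT locality `M_{h′_k}∘P′∘M_{1−ψ′_k} = 0` (displayed; n15-c∕430 discharges it for the (PC) summand).
[cite: Balaban1984PropagatorsII, (2.91)–(2.93) p.239 (shape); Balaban1985BackgroundPropagators, (3.50) p.400, (3.88)–(3.89) p.409 (shapes)] -/
theorem mulOp_scH'_comp_conj_comp_mulOp_scPsi' (η : ℝ) (R : Fin (d + 1) ⊕ Fin (d + 1) → ScX' d L mv kk r hL → Matrix ι ι ℝ) (W W' : ScX' d L mv kk r hL → Matrix ι ι ℝ)
    (P' : (ScX' d L mv kk r hL × ι → ℝ) →ₗ[ℝ] (ScX' d L mv kk r hL × ι → ℝ)) (k : Fin (d + 1) → ZMod (2 * L)) (hhχ : ∀ x, scH' d L mv kk r hL k x ≠ 0 → scChi' d L mv kk r hL k x ≠ 0)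
    (hPloc : mulOp (fun p : ScX' d L mv kk r hL × ι => scH' d L mv kk r hL k p.1) ∘ₗ P' ∘ₗ mulOp (fun p : ScX' d L mv kk r hL × ι => 1 - scPsi' d L mv kk r hL k p.1) = 0) :
    mulOp (fun p : ScX' d L mv kk r hL × ι => scH' d L mv kk r hL k p.1) ∘ₗ (mmulOp W ∘ₗ (covLapM (scShift' d L mv kk r hL) η R + P') ∘ₗ mmulOp W') ∘ₗ mulOp (fun p : ScX' d L mv kk r hL × ι => scPsi' d L mv kk r hL k p.1) =
      mulOp (fun p : ScX' d L mv kk r hL × ι => scH' d L mv kk r hL k p.1) ∘ₗ (mmulOp W ∘ₗ (covLapM (scShift' d L mv kk r hL) η R + P') ∘ₗ mmulOp W') := by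
  have h0 := mulOp_fst_comp_conj_comp_mulOp_fst_eq_zero (a := scH' d L mv kk r hL k) (b := fun x => 1 - scPsi' d L mv kk r hL k x) W W'
    (mulOp_comp_add_comp_mulOp_eq_zero (mulOp_scH'_comp_covLapM_comp_one_sub_scPsi' ι hM hm₂ hfit₂ hS0 η R k hhχ) hPloc)
  have e : mulOp (fun p : ScX' d L mv kk r hL × ι => 1 - scPsi' d L mv kk r hL k p.1) = LinearMap.id - mulOp (fun p : ScX' d L mv kk r hL × ι => scPsi' d L mv kk r hL k p.1) := by
    refine LinearMap.ext fun f => funext fun p => ?_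
    simp only [mulOp_apply, LinearMap.sub_apply, LinearMap.id_apply, Pi.sub_apply, sub_mul, one_mul]
  rw [e, LinearMap.comp_sub, LinearMap.comp_id, LinearMap.comp_sub, sub_eq_zero] at h0
  exact h0.symm

end Support

end Summit.QuantumFields.YangMills.BalabanUVNodes.N15.Gluing

end
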